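import Summits.NavierStokesRegularity.NavierStokesRegularity.Theses.FilamentSkeletonRss
import Literature.Analysis.FluidPDE.GaussianVortexLinearLam

/-!
# `CoreGluingGivenInvertibility` (stmt-NavierStokesRegularity-17944) — negative lemma, calculus part:
# `L_λ − ω∂_θ` on a general centred Gaussian

Route `FilamentSkeletonRss`, crux `CoreGluingGivenInvertibility := CoreLinearInvertibility → CoreGluing`
(disprover's file, lands with `--supports stmt-NavierStokesRegularity-17944`; theorems only).  Companion
of `Negative/GaussianCoreRange` (diagonal Gaussians, `ω = 0`).  Here: the derivatives of
`e^{−(p x₀² + 2r x₀x₁ + s x₁²)}` and the closed form of the local planar core operator WITH the ambient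
frame rotation, `L_λ w − ω ∂_θ w` (`L_λ = strainedVorticityOperator λ`, `∂_θ = x₀∂₁ − x₁∂₀`), on such a
Gaussian (`rotStrainedOp_expNegQuadForm`).  The classification of its Gaussian steady states (unique,
tilted iff `λω ≠ 0`, decaying iff `λ² < 1 + 4ω²`) is in `Negative/AmbientRotationTilt`.
-/

noncomputable section

namespace Summit.NavierStokesRegularity.NavierStokesRegularity.Theorems.CoreGluingGivenInvertibility.Negative

open Literature.Analysis.FluidPDE
open scoped Laplacian

set_option linter.dupNamespace false

section QuadForm

variable (p r s : ℝ)

/-- `D(p y₀² + 2r y₀y₁ + s y₁²)(x) = (2p x₀ + 2r x₁) dy₀ + (2r x₀ + 2s x₁) dy₁`. [folklore] -/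
theorem hasFDerivAt_quadForm (x : EuclideanSpace ℝ (Fin 2)) :
    HasFDerivAt (fun y : EuclideanSpace ℝ (Fin 2) => p * y 0 ^ 2 + 2 * r * (y 0 * y 1) + s * y 1 ^ 2)
      ((2 * p * x 0 + 2 * r * x 1) • (EuclideanSpace.proj 0 : EuclideanSpace ℝ (Fin 2) →L[ℝ] ℝ) +
        (2 * r * x 0 + 2 * s * x 1) • (EuclideanSpace.proj 1 : EuclideanSpace ℝ (Fin 2) →L[ℝ] ℝ)) x := by
  have h0 : HasFDerivAt (fun y : EuclideanSpace ℝ (Fin 2) => y 0)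
      (EuclideanSpace.proj 0 : EuclideanSpace ℝ (Fin 2) →L[ℝ] ℝ) x :=
    (EuclideanSpace.proj (0 : Fin 2) : EuclideanSpace ℝ (Fin 2) →L[ℝ] ℝ).hasFDerivAt
  have h1 : HasFDerivAt (fun y : EuclideanSpace ℝ (Fin 2) => y 1)
      (EuclideanSpace.proj 1 : EuclideanSpace ℝ (Fin 2) →L[ℝ] ℝ) x :=
    (EuclideanSpace.proj (1 : Fin 2) : EuclideanSpace ℝ (Fin 2) →L[ℝ] ℝ).hasFDerivAt
  have hp := (h0.pow 2).const_mul p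
  have hr := (h0.mul h1).const_mul (2 * r)
  have hs := (h1.pow 2).const_mul s
  refine ((hp.add hr).add hs).congr_fderiv ?_
  ext v
  simp
  ring

/-- The centred Gaussian `exp(−(p y₀² + 2r y₀y₁ + s y₁²))` and its derivative. [folklore] -/
theorem hasFDerivAt_exp_neg_quadForm (x : EuclideanSpace ℝ (Fin 2)) :
    HasFDerivAt (fun y : EuclideanSpace ℝ (Fin 2) =>
        Real.exp (-(p * y 0 ^ 2 + 2 * r * (y 0 * y 1) + s * y 1 ^ 2)))
      (Real.exp (-(p * x 0 ^ 2 + 2 * r * (x 0 * x 1) + s * x 1 ^ 2)) •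
        -((2 * p * x 0 + 2 * r * x 1) • (EuclideanSpace.proj 0 : EuclideanSpace ℝ (Fin 2) →L[ℝ] ℝ) +
          (2 * r * x 0 + 2 * s * x 1) • (EuclideanSpace.proj 1 : EuclideanSpace ℝ (Fin 2) →L[ℝ] ℝ))) x :=
  (hasFDerivAt_quadForm p r s x).neg.exp

/-- `∂₀ e^{−φ} = −(2p x₀ + 2r x₁) e^{−φ}`. [folklore] -/
theorem fderiv_exp_neg_quadForm_zero (x : EuclideanSpace ℝ (Fin 2)) :
    fderiv ℝ (fun y : EuclideanSpace ℝ (Fin 2) =>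
        Real.exp (-(p * y 0 ^ 2 + 2 * r * (y 0 * y 1) + s * y 1 ^ 2))) x
      (EuclideanSpace.single 0 (1 : ℝ)) =
      -(2 * p * x 0 + 2 * r * x 1) *
        Real.exp (-(p * x 0 ^ 2 + 2 * r * (x 0 * x 1) + s * x 1 ^ 2)) := by
  rw [(hasFDerivAt_exp_neg_quadForm p r s x).fderiv]
  simp
  ring

/-- `∂₁ e^{−φ} = −(2r x₀ + 2s x₁) e^{−φ}`. [folklore] -/
theorem fderiv_exp_neg_quadForm_one (x : EuclideanSpace ℝ (Fin 2)) :
    fderiv ℝ (fun y : EuclideanSpace ℝ (Fin 2) =>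
        Real.exp (-(p * y 0 ^ 2 + 2 * r * (y 0 * y 1) + s * y 1 ^ 2))) x
      (EuclideanSpace.single 1 (1 : ℝ)) =
      -(2 * r * x 0 + 2 * s * x 1) *
        Real.exp (-(p * x 0 ^ 2 + 2 * r * (x 0 * x 1) + s * x 1 ^ 2)) := by
  rw [(hasFDerivAt_exp_neg_quadForm p r s x).fderiv]
  simp
  ring

/-- `e^{−φ}` is smooth. [folklore] -/
theorem contDiff_exp_neg_quadForm {n : WithTop ℕ∞} :
    ContDiff ℝ n fun y : EuclideanSpace ℝ (Fin 2) =>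
      Real.exp (-(p * y 0 ^ 2 + 2 * r * (y 0 * y 1) + s * y 1 ^ 2)) := by
  have h0 := (EuclideanSpace.proj (0 : Fin 2) : EuclideanSpace ℝ (Fin 2) →L[ℝ] ℝ).contDiff (n := n)
  have h1 := (EuclideanSpace.proj (1 : Fin 2) : EuclideanSpace ℝ (Fin 2) →L[ℝ] ℝ).contDiff (n := n)
  exact Real.contDiff_exp.comp
    (((contDiff_const.mul (h0.pow 2)).add (contDiff_const.mul (h0.mul h1))).add
      (contDiff_const.mul (h1.pow 2))).neg

/-- `∂₀∂₀ e^{−φ} = ((2p x₀ + 2r x₁)² − 2p) e^{−φ}`. [folklore] -/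
theorem fderiv_fderiv_exp_neg_quadForm_zero (x : EuclideanSpace ℝ (Fin 2)) :
    fderiv ℝ (fun y => fderiv ℝ (fun z : EuclideanSpace ℝ (Fin 2) =>
        Real.exp (-(p * z 0 ^ 2 + 2 * r * (z 0 * z 1) + s * z 1 ^ 2))) y
        (EuclideanSpace.single 0 (1 : ℝ))) x (EuclideanSpace.single 0 (1 : ℝ)) =
      ((2 * p * x 0 + 2 * r * x 1) ^ 2 - 2 * p) *
        Real.exp (-(p * x 0 ^ 2 + 2 * r * (x 0 * x 1) + s * x 1 ^ 2)) := by
  have hfun : (fun y => fderiv ℝ (fun z : EuclideanSpace ℝ (Fin 2) =>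
      Real.exp (-(p * z 0 ^ 2 + 2 * r * (z 0 * z 1) + s * z 1 ^ 2))) y
        (EuclideanSpace.single 0 (1 : ℝ))) =
      fun y : EuclideanSpace ℝ (Fin 2) =>
        (-(2 * p * y 0 + 2 * r * y 1)) *
          Real.exp (-(p * y 0 ^ 2 + 2 * r * (y 0 * y 1) + s * y 1 ^ 2)) := by
    funext y; rw [fderiv_exp_neg_quadForm_zero]
  have h0 : HasFDerivAt (fun y : EuclideanSpace ℝ (Fin 2) => y 0)
      (EuclideanSpace.proj 0 : EuclideanSpace ℝ (Fin 2) →L[ℝ] ℝ) x :=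
    (EuclideanSpace.proj (0 : Fin 2) : EuclideanSpace ℝ (Fin 2) →L[ℝ] ℝ).hasFDerivAt
  have h1 : HasFDerivAt (fun y : EuclideanSpace ℝ (Fin 2) => y 1)
      (EuclideanSpace.proj 1 : EuclideanSpace ℝ (Fin 2) →L[ℝ] ℝ) x :=
    (EuclideanSpace.proj (1 : Fin 2) : EuclideanSpace ℝ (Fin 2) →L[ℝ] ℝ).hasFDerivAt
  have hP : HasFDerivAt (fun y : EuclideanSpace ℝ (Fin 2) => -(2 * p * y 0 + 2 * r * y 1))
      (-((2 * p) • (EuclideanSpace.proj 0 : EuclideanSpace ℝ (Fin 2) →L[ℝ] ℝ) +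
        (2 * r) • (EuclideanSpace.proj 1 : EuclideanSpace ℝ (Fin 2) →L[ℝ] ℝ))) x :=
    ((h0.const_mul (2 * p)).add (h1.const_mul (2 * r))).neg
  have h2 := (hP.mul (hasFDerivAt_exp_neg_quadForm p r s x)).fderiv
  simp only [Pi.mul_def] at h2
  rw [hfun, h2]
  simp
  ring

/-- `∂₁∂₁ e^{−φ} = ((2r x₀ + 2s x₁)² − 2s) e^{−φ}`. [folklore] -/
theorem fderiv_fderiv_exp_neg_quadForm_one (x : EuclideanSpace ℝ (Fin 2)) :
    fderiv ℝ (fun y => fderiv ℝ (fun z : EuclideanSpace ℝ (Fin 2) =>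
        Real.exp (-(p * z 0 ^ 2 + 2 * r * (z 0 * z 1) + s * z 1 ^ 2))) y
        (EuclideanSpace.single 1 (1 : ℝ))) x (EuclideanSpace.single 1 (1 : ℝ)) =
      ((2 * r * x 0 + 2 * s * x 1) ^ 2 - 2 * s) *
        Real.exp (-(p * x 0 ^ 2 + 2 * r * (x 0 * x 1) + s * x 1 ^ 2)) := by
  have hfun : (fun y => fderiv ℝ (fun z : EuclideanSpace ℝ (Fin 2) =>
      Real.exp (-(p * z 0 ^ 2 + 2 * r * (z 0 * z 1) + s * z 1 ^ 2))) y
        (EuclideanSpace.single 1 (1 : ℝ))) =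
      fun y : EuclideanSpace ℝ (Fin 2) =>
        (-(2 * r * y 0 + 2 * s * y 1)) *
          Real.exp (-(p * y 0 ^ 2 + 2 * r * (y 0 * y 1) + s * y 1 ^ 2)) := by
    funext y; rw [fderiv_exp_neg_quadForm_one]
  have h0 : HasFDerivAt (fun y : EuclideanSpace ℝ (Fin 2) => y 0)
      (EuclideanSpace.proj 0 : EuclideanSpace ℝ (Fin 2) →L[ℝ] ℝ) x :=
    (EuclideanSpace.proj (0 : Fin 2) : EuclideanSpace ℝ (Fin 2) →L[ℝ] ℝ).hasFDerivAt
  have h1 : HasFDerivAt (fun y : EuclideanSpace ℝ (Fin 2) => y 1)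
      (EuclideanSpace.proj 1 : EuclideanSpace ℝ (Fin 2) →L[ℝ] ℝ) x :=
    (EuclideanSpace.proj (1 : Fin 2) : EuclideanSpace ℝ (Fin 2) →L[ℝ] ℝ).hasFDerivAt
  have hP : HasFDerivAt (fun y : EuclideanSpace ℝ (Fin 2) => -(2 * r * y 0 + 2 * s * y 1))
      (-((2 * r) • (EuclideanSpace.proj 0 : EuclideanSpace ℝ (Fin 2) →L[ℝ] ℝ) +
        (2 * s) • (EuclideanSpace.proj 1 : EuclideanSpace ℝ (Fin 2) →L[ℝ] ℝ))) x :=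
    ((h0.const_mul (2 * r)).add (h1.const_mul (2 * s))).neg
  have h2 := (hP.mul (hasFDerivAt_exp_neg_quadForm p r s x)).fderiv
  simp only [Pi.mul_def] at h2
  rw [hfun, h2]
  simp
  ring

/-- `Δ e^{−φ} = ((2p x₀ + 2r x₁)² + (2r x₀ + 2s x₁)² − 2p − 2s) e^{−φ}`. [folklore] -/
theorem laplacian_exp_neg_quadForm (x : EuclideanSpace ℝ (Fin 2)) :
    Δ (fun z : EuclideanSpace ℝ (Fin 2) =>
        Real.exp (-(p * z 0 ^ 2 + 2 * r * (z 0 * z 1) + s * z 1 ^ 2))) x =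
      ((2 * p * x 0 + 2 * r * x 1) ^ 2 + (2 * r * x 0 + 2 * s * x 1) ^ 2 - 2 * p - 2 * s) *
        Real.exp (-(p * x 0 ^ 2 + 2 * r * (x 0 * x 1) + s * x 1 ^ 2)) := by
  rw [laplacian_eq_fin_two (contDiff_exp_neg_quadForm p r s), fderiv_fderiv_exp_neg_quadForm_zero,
    fderiv_fderiv_exp_neg_quadForm_one]
  ring

/-- **`L_λ − ω∂_θ` on a general centred Gaussian, closed form.**  With `w = k e^{−(p x₀² + 2r x₀x₁ + s x₁²)}`
and `∂_θ w = x₀∂₁w − x₁∂₀w`,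
`L_λ w − ω ∂_θ w = w · (c₀₀ x₀² + 2 c₀₁ x₀x₁ + c₁₁ x₁² + (1 − 2p − 2s))`,
`c₀₀ = 4(p²+r²) − (1+λ)p + 2ωr`, `c₁₁ = 4(r²+s²) − (1−λ)s − 2ωr`, `c₀₁ = 4r(p+s) − r − ω(p−s)`. [folklore] -/
theorem rotStrainedOp_expNegQuadForm (lam ω k : ℝ) (x : EuclideanSpace ℝ (Fin 2)) :
    strainedVorticityOperator lam (fun y : EuclideanSpace ℝ (Fin 2) =>
        k * Real.exp (-(p * y 0 ^ 2 + 2 * r * (y 0 * y 1) + s * y 1 ^ 2))) x -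
      ω * (x 0 * fderiv ℝ (fun y : EuclideanSpace ℝ (Fin 2) =>
          k * Real.exp (-(p * y 0 ^ 2 + 2 * r * (y 0 * y 1) + s * y 1 ^ 2))) x
            (EuclideanSpace.single 1 (1 : ℝ)) -
        x 1 * fderiv ℝ (fun y : EuclideanSpace ℝ (Fin 2) =>
          k * Real.exp (-(p * y 0 ^ 2 + 2 * r * (y 0 * y 1) + s * y 1 ^ 2))) x
            (EuclideanSpace.single 0 (1 : ℝ))) =
      k * Real.exp (-(p * x 0 ^ 2 + 2 * r * (x 0 * x 1) + s * x 1 ^ 2)) *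
        ((4 * (p ^ 2 + r ^ 2) - (1 + lam) * p + 2 * ω * r) * x 0 ^ 2 +
          2 * (4 * r * (p + s) - r - ω * (p - s)) * (x 0 * x 1) +
          (4 * (r ^ 2 + s ^ 2) - (1 - lam) * s - 2 * ω * r) * x 1 ^ 2 +
          (1 - 2 * p - 2 * s)) := by
  have hc := contDiff_exp_neg_quadForm p r s (n := 2)
  have hd : DifferentiableAt ℝ (fun y : EuclideanSpace ℝ (Fin 2) =>
      Real.exp (-(p * y 0 ^ 2 + 2 * r * (y 0 * y 1) + s * y 1 ^ 2))) x :=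
    (contDiff_exp_neg_quadForm p r s (n := 1)).differentiable (by simp) x
  have hΔ : Δ (fun y : EuclideanSpace ℝ (Fin 2) =>
      k * Real.exp (-(p * y 0 ^ 2 + 2 * r * (y 0 * y 1) + s * y 1 ^ 2))) x =
      k * Δ (fun y : EuclideanSpace ℝ (Fin 2) =>
        Real.exp (-(p * y 0 ^ 2 + 2 * r * (y 0 * y 1) + s * y 1 ^ 2))) x := by
    have := InnerProductSpace.laplacian_smul k (hc.contDiffAt (x := x))
    simpa [Pi.smul_def, smul_eq_mul] using this
  rw [strainedVorticityOperator, hΔ, fderiv_const_mul hd, FunLike.coe_smul, Pi.smul_apply,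
    Pi.smul_apply, smul_eq_mul, smul_eq_mul, fderiv_exp_neg_quadForm_zero,
    fderiv_exp_neg_quadForm_one, laplacian_exp_neg_quadForm]
  ring

end QuadForm

end Summit.NavierStokesRegularity.NavierStokesRegularity.Theorems.CoreGluingGivenInvertibility.Negative
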